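import Summits.QuantumFields.BalabanUV.Beta.GAN24.ExitFaceCurrentCellTotalsStep
import Summits.QuantumFields.BalabanUV.Beta.GAN24.ExitFaceCurrentDivFree

/-!
# `BalabanUV.Beta.GAN24.VHWordsZeroAllLevels` — binder row G-an2-4 ∕ (CONV-C), W-slot CT-W, conservation law (C)∕(C)sym AT ALL LEVELS, (W9) 24_j of leaf-06 g52's division
# (`HOME/b2b-balaban-gan24-formalise-leaf-06/g52/C-LEVELS-GE1.md` §17) CLOSED: **THE `VH_c ⊗ S^E` WORD AND ITS SWAP OF THE DRESSED LEVEL-`(j+1)` SOURCE VANISH PER BOND, FOR EVERY `j`,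
# UNCONDITIONALLY** — g68's E `ExitFaceCurrentCellTotalsStep.tsum_noFF_left_E_right_word_eq_zero_succ_of_divFree` (24_{j+1} ⟸ (D)_{j+1}) with its hypothesis `(hdiv)` discharged BY TYPE by
# g68's `ExitFaceCurrentDivFree.exitFace_pairCurrent_divFree` (the (D)-tower); the ten-line corollary announced in the lineage's journal [LEAF04-G68-CLOSE].

NOT IN PRINT; OUR BOOKKEEPING ([folklore] two applications BY NAME; G-an2-4 formalisation swarm, leaf prover `b2b-balaban-gan24-formalise-leaf-04`, gen 69).  HONEST FRAMING (cell contract,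
verbatim): «discharging `BetaPertH` makes Bałaban's UV stability UNCONDITIONAL — a real constructive-QFT result; it is NOT the continuum limit and NOT the Clay problem.»  HONEST DEPENDENCY
(verbatim): «continuum YM on T⁴ ⇐ BetaPertH ∧ nine spine estimates (0/9 proved); BetaPertH ⇐ (D1) ∧ (D4) ∧ CAP+tail; G-an2-4 gates asym, D1 and NE2/3/4.»

WHAT ([folklore]; generic `d`, `3 ≤ Lc`, in-block root, every `j`, all units `s_f s_m`, every `cΛ`, the Ward pins `cE = Lc^{d+1}`, `cVH = −Lc^{d+1}·½·Lc^{d+1}`, `C₀ = Lc^{d+1}·wE_{j+1}` of E, ANY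
local partner family `S′` without ff block; 0 `def`, 0 cited facts, 0 `def … : Prop`, 0 sorry): **`vhE_word_eq_zero_succ`** (the direct word `Σ'_{u′} FF[(V^{S′}_{μc} ∘ X̃♮_{j+1}) ∘ V^{E}_{νu′}] = 0`)
and **`EvH_swap_word_eq_zero_succ`** (the swap word).  Asserts NO value of Bałaban's tables; discharges NOTHING of (C)sym ∕ (Q-D) ∕ (Q-D-rate) ∕ «T2Shape» ∕ «T2Drift» ∕ (hW, hWall); NEVER
«G-an2-4 closed» as (CONV-C); NOT D1, NOT `BetaPertH`, NOT continuum, NOT Clay.  2026-08-23; no existing file touched.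
-/

noncomputable section

open Finset
open scoped BigOperators
open Literature.MathematicalPhysics.QuantumFieldTheory
open Literature.MathematicalPhysics.QuantumFieldTheory.Balaban1983to89
open Literature.MathematicalPhysics.QuantumFieldTheory.Balaban1983to89.Beta
open ExpKernelCalculus (Site MKer)
open OneStepResolventKernel (Fib LocStencil)
open OneStepKernelFamily (KInvStep vertexOfK)
open BalabanStepJetsSucc (wE)
open AffineAveraging (box toSite)
open Summit.QuantumFields.BalabanUV.Beta.AxialDressingRooted (coDressKBmAt)
open Summit.QuantumFields.BalabanUV.Beta.HessKerDressedUnits (unitK unitS)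
open Summit.QuantumFields.BalabanUV.Beta.SpineRooted (e3OfK)
open Summit.QuantumFields.BalabanUV.Beta.WardLocusRecursive (SrecAt)
open Summit.QuantumFields.BalabanUV.Beta.GAN24.ExitFaceCurrentCellTotalsStep (tsum_noFF_left_E_right_word_eq_zero_succ_of_divFree tsum_E_left_noFF_right_swap_word_eq_zero_succ_of_divFree)
open Summit.QuantumFields.BalabanUV.Beta.GAN24.ExitFaceCurrentDivFree (exitFace_pairCurrent_divFree)

namespace Summit.QuantumFields.BalabanUV.Beta.GAN24.VHWordsZeroAllLevels

variable {d : ℕ} {Lc : ℕ} [NeZero Lc] {r : Fin (d + 1) → ℕ} {S' : Fin (d + 1) → Site (d + 1) → MKer (d + 1) (Fib d)} {Cs δs : ℝ} {μ ν α β : Fin (d + 1)}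

/-- [folklore] **24_{j+1}, THE DIRECT WORD, UNCONDITIONALLY**: `Σ'_{u′} FF[(V^{S′}_{μc} ∘ X̃♮_{j+1}) ∘ V^{E}_{νu′}] = 0` for every bond `c`, every `j` (E's word with `(hdiv)` := the (D)-tower). -/
theorem vhE_word_eq_zero_succ (hLc : 3 ≤ Lc) (hr : r ∈ box (d + 1) Lc) (sf sm cΛ : ℝ) (j : ℕ) (hS : LocStencil S' Cs δs) (hδs : 0 < δs)
    (hSff : ∀ (κ' : Fin (d + 1)) (t x z : Site (d + 1)) (α' a : Fin (d + 1)), S' κ' t x z (Sum.inl α') (Sum.inl a) = 0) (c : Site (d + 1)) :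
    ∑' u' : Site (d + 1), ∑' yw : Site (d + 1) × Site (d + 1), (if yw.1 α % (Lc : ℤ) = (Lc : ℤ) - 1 then (1 : ℝ) else 0) * (if yw.2 β % (Lc : ℤ) = (Lc : ℤ) - 1 then (1 : ℝ) else 0) *
        ExpKernelCalculus.comp (ExpKernelCalculus.comp (vertexOfK (unitK sf sm (coDressKBmAt (toSite r) Lc (KInvStep (d := d) Lc (j + 1)))) Lc (unitS sf sm S') μ c)
          (unitK sf sm (coDressKBmAt (toSite r) Lc (KInvStep (d := d) Lc (j + 1)))))
          (vertexOfK (unitK sf sm (coDressKBmAt (toSite r) Lc (KInvStep (d := d) Lc (j + 1)))) Lc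
            (unitS sf sm (fun κ t => ((Lc : ℝ) ^ (d + 1) * wE d Lc (j + 1)) • e3OfK Lc (coDressKBmAt (toSite r) Lc (KInvStep (d := d) Lc j))
              (SrecAt d Lc (toSite r) ((Lc : ℝ) ^ (d + 1)) (-((Lc : ℝ) ^ (d + 1) * (1 / 2) * (Lc : ℝ) ^ (d + 1))) cΛ j) κ t)) ν u')
          yw.1 yw.2 (Sum.inl α) (Sum.inl β) = 0 :=
  tsum_noFF_left_E_right_word_eq_zero_succ_of_divFree hLc hr sf sm cΛ j hS hδs hSff c
    (fun p => exitFace_pairCurrent_divFree hr sf sm _ _ cΛ _ j ν β p)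

/-- [folklore] **24_{j+1}, THE SWAP WORD, UNCONDITIONALLY**: `Σ'_{u′} FF[(V^{E}_{νu′} ∘ X̃♮_{j+1}) ∘ V^{S′}_{μc}] = 0` for every bond `c`, every `j`. -/
theorem EvH_swap_word_eq_zero_succ (hLc : 3 ≤ Lc) (hr : r ∈ box (d + 1) Lc) (sf sm cΛ : ℝ) (j : ℕ) (hS : LocStencil S' Cs δs) (hδs : 0 < δs)
    (hSff : ∀ (κ' : Fin (d + 1)) (t x z : Site (d + 1)) (α' a : Fin (d + 1)), S' κ' t x z (Sum.inl α') (Sum.inl a) = 0) (c : Site (d + 1)) :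
    ∑' u' : Site (d + 1), ∑' yw : Site (d + 1) × Site (d + 1), (if yw.1 α % (Lc : ℤ) = (Lc : ℤ) - 1 then (1 : ℝ) else 0) * (if yw.2 β % (Lc : ℤ) = (Lc : ℤ) - 1 then (1 : ℝ) else 0) *
        ExpKernelCalculus.comp (ExpKernelCalculus.comp (vertexOfK (unitK sf sm (coDressKBmAt (toSite r) Lc (KInvStep (d := d) Lc (j + 1)))) Lc
            (unitS sf sm (fun κ t => ((Lc : ℝ) ^ (d + 1) * wE d Lc (j + 1)) • e3OfK Lc (coDressKBmAt (toSite r) Lc (KInvStep (d := d) Lc j))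
              (SrecAt d Lc (toSite r) ((Lc : ℝ) ^ (d + 1)) (-((Lc : ℝ) ^ (d + 1) * (1 / 2) * (Lc : ℝ) ^ (d + 1))) cΛ j) κ t)) ν u')
          (unitK sf sm (coDressKBmAt (toSite r) Lc (KInvStep (d := d) Lc (j + 1)))))
          (vertexOfK (unitK sf sm (coDressKBmAt (toSite r) Lc (KInvStep (d := d) Lc (j + 1)))) Lc (unitS sf sm S') μ c)
          yw.1 yw.2 (Sum.inl α) (Sum.inl β) = 0 :=
  tsum_E_left_noFF_right_swap_word_eq_zero_succ_of_divFree hLc hr sf sm cΛ j hS hδs hSff c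
    (fun p => exitFace_pairCurrent_divFree hr sf sm _ _ cΛ _ j ν α p)

end Summit.QuantumFields.BalabanUV.Beta.GAN24.VHWordsZeroAllLevels

end
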